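import Mathlib
import Summits.ValiantsHypothesis.ValiantsHypothesis.Theorems.KPlusLogSqLawWeakLiftingTowerGraftSkewBlockAxisPairSharp
import Summits.ValiantsHypothesis.ValiantsHypothesis.Theorems.KPlusLogSqLawWeakLiftingTowerGraftSkewBlockCornerGraftSharp

/-!
# Tower graft line — the indefinite axis-pair no-go IN THE PLANNERS' SHAPE (one index type `Fin (2q+4)`, real symmetric far letter)

Calibration file for the line `Cruxes/WeakLifting/Lines/tower_graft.lean` (crux `WeakLifting` = stmt-ValiantsHypothesis-19561); transport of
`…SkewBlockAxisPairSharp.skewBlock_axisPair_quadratic_tower` along `Fin (q+2) ⊕ Fin (q+2) ≃ Fin (2q+4)` (as p708324 did for the corner):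
S5's object verbatim — symmetric letters `S : Fin 3 → Matrix (Fin (2q+4)) (Fin (2q+4)) ℝ` on the genuine `(2q+4)`-tower `(0, 1, D)`, a REAL
symmetric far letter `E_aa − E_bb` grafted as `X^{D'} • (E_aa − E_bb).map C`, and the four event polynomials of `…FoldLawAxisPair` written on
`Fin (2q+4)`.  NO stub is claimed.

* `updateRow_single_submatrix_equiv`, `transvection_submatrix_equiv` — relabelling bookkeeping.
* ★ `axisPair_quadratic_tower_fin (q)` — ∃ `D` with tower conjuncts for `m = 2q+4`, and for EVERY exponent `D'` symmetric letters `S` and indices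
  `a ≠ b` with `Z₊(det G) = 0` (E0), `Z₊(det((G.updateRow a e_a).updateRow b e_b)) = 0` (Er), both fold factors
  `adj((transvection b a (±1))ᵀ G (transvection b a (±1)))_{bb}` rootless (Ed), and `Z₊(det(G + X^{D'}·(E_aa − E_bb))) ≥ (q+2)(q+5) = m²/4 + 3m/2`.

HONEST FRAMING: relabelling only; nothing on S4/S4b/S5/S5ᴸ, TowerB, `WeakLifting`, Conjecture B, `MatrixDescartes` (18050) or `VP ≠ VNP`.  Def-free.
Seat: prover val-sym-lift-p2 g21, `--supports stmt-ValiantsHypothesis-19561`.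
-/

-- `Summit.ValiantsHypothesis.ValiantsHypothesis.…` repeats a component by the D-0017 layout
-- (single-conjunct summit), which the `dupNamespace` linter flags; the name is mandated.
set_option linter.dupNamespace false

namespace Summit.ValiantsHypothesis.ValiantsHypothesis.Theorems.KPlusLogSqLaw.TowerGraft

open Polynomial Matrix
open scoped BigOperators Polynomial

section AxisPairFinShape

/-- a unit-row update commutes with relabelling along an equivalence. [folklore] -/
theorem updateRow_single_submatrix_equiv {m n : Type*} [DecidableEq m] [DecidableEq n] {R : Type*} [Semiring R] (σ : n ≃ m)
    (M : Matrix m m R) (x : n) :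
    (M.submatrix σ σ).updateRow x (Pi.single x (1 : R)) = (M.updateRow (σ x) (Pi.single (σ x) (1 : R))).submatrix σ σ := by
  ext y z
  simp only [Matrix.updateRow_apply, Matrix.submatrix_apply, Pi.single_apply, σ.apply_eq_iff_eq]

/-- a transvection relabelled along an equivalence. [folklore] -/
theorem transvection_submatrix_equiv {m n : Type*} [DecidableEq m] [DecidableEq n] {R : Type*} [CommRing R] (σ : n ≃ m) (i j : n) (c : R) :
    (Matrix.transvection (σ i) (σ j) c).submatrix σ σ = Matrix.transvection i j c := by
  ext y z
  simp only [Matrix.transvection, Matrix.submatrix_apply, Matrix.add_apply, Matrix.one_apply, Matrix.single_apply, σ.apply_eq_iff_eq]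

/-- **THE INDEFINITE AXIS-PAIR NO-GO IN THE PLANNERS' SHAPE.** [this work] -/
theorem axisPair_quadratic_tower_fin (q : ℕ) :
    ∃ D : ℕ, (∀ l l' : Fin 3, l < l' → (2 * q + 4) * (![0, 1, D] : Fin 3 → ℕ) l < (![0, 1, D] : Fin 3 → ℕ) l') ∧
      (∀ l : Fin 3, (2 * q + 4) * (![0, 1, D] : Fin 3 → ℕ) l < (2 * q + 4) * D + 1) ∧
      ∀ D' : ℕ, ∃ (S : Fin 3 → Matrix (Fin (2 * q + 4)) (Fin (2 * q + 4)) ℝ) (a b : Fin (2 * q + 4)), a ≠ b ∧ (∀ l, (S l).IsSymm) ∧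
        ((∑ l, (X : ℝ[X]) ^ (![0, 1, D] : Fin 3 → ℕ) l • (S l).map C).det.roots.toFinset.filter (fun t => 0 < t)).card = 0 ∧
        (((((∑ l, (X : ℝ[X]) ^ (![0, 1, D] : Fin 3 → ℕ) l • (S l).map C).updateRow a (Pi.single a 1)).updateRow b
          (Pi.single b 1)).det).roots.toFinset.filter (fun t => 0 < t)).card = 0 ∧
        ((((Matrix.transvection b a (1 : ℝ[X]))ᵀ * (∑ l, (X : ℝ[X]) ^ (![0, 1, D] : Fin 3 → ℕ) l • (S l).map C) *
          Matrix.transvection b a (1 : ℝ[X])).adjugate b b).roots.toFinset.filter (fun t => 0 < t)).card = 0 ∧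
        ((((Matrix.transvection b a (-1 : ℝ[X]))ᵀ * (∑ l, (X : ℝ[X]) ^ (![0, 1, D] : Fin 3 → ℕ) l • (S l).map C) *
          Matrix.transvection b a (-1 : ℝ[X])).adjugate b b).roots.toFinset.filter (fun t => 0 < t)).card = 0 ∧
        (q + 2) * (q + 5) ≤ ((((∑ l, (X : ℝ[X]) ^ (![0, 1, D] : Fin 3 → ℕ) l • (S l).map C) +
          (X : ℝ[X]) ^ D' • (Matrix.single a a (1 : ℝ) - Matrix.single b b (1 : ℝ)).map C).det).roots.toFinset.filter
          (fun t => 0 < t)).card := by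
  classical
  obtain ⟨D, B, htow, htop, hall⟩ := skewBlock_axisPair_quadratic_tower q
  have h2q : 2 * (q + 2) = 2 * q + 4 := by ring
  rw [h2q] at htow htop
  have hm : q + 2 + (q + 2) = 2 * q + 4 := by ring
  set e : Fin (q + 2) ⊕ Fin (q + 2) ≃ Fin (2 * q + 4) := finSumFinEquiv.trans (finCongr hm) with he
  refine ⟨D, htow, htop, fun D' => ?_⟩
  obtain ⟨η, hη, h1, h2, h3, h4, h5⟩ := hall D'
  set T : Fin 3 → Matrix (Fin (q + 2) ⊕ Fin (q + 2)) (Fin (q + 2) ⊕ Fin (q + 2)) ℝ := fun l =>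
    Matrix.fromBlocks (if l = 0 then η • (1 : Matrix (Fin (q + 2)) (Fin (q + 2)) ℝ) else 0) (B l) (B l)ᵀ
      (if l = 0 then -(η • (1 : Matrix (Fin (q + 2)) (Fin (q + 2)) ℝ)) else 0) with hT
  set a : Fin (2 * q + 4) := e (Sum.inr 0) with ha
  set b : Fin (2 * q + 4) := e (Sum.inr 1) with hb
  have hab : a ≠ b := by
    rw [ha, hb]; intro h; have := e.injective h; simp at this
  have hσa : e.symm a = Sum.inr 0 := by rw [ha, Equiv.symm_apply_apply]
  have hσb : e.symm b = Sum.inr 1 := by rw [hb, Equiv.symm_apply_apply]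
  -- the relabelled pencil
  have hG : (∑ l, (X : ℝ[X]) ^ (![0, 1, D] : Fin 3 → ℕ) l • ((T l).submatrix e.symm e.symm).map C) =
      (∑ l, (X : ℝ[X]) ^ (![0, 1, D] : Fin 3 → ℕ) l • (T l).map C).submatrix e.symm e.symm := (submatrix_pencil' _ _ _ _).symm
  refine ⟨fun l => (T l).submatrix e.symm e.symm, a, b, hab, fun l => (isSymm_skewBlock_letter 0 l η B).submatrix _, ?_, ?_, ?_, ?_, ?_⟩
  · rw [hG, Matrix.det_submatrix_equiv_self]; exact h1
  · rw [hG, updateRow_single_submatrix_equiv, hσa, updateRow_single_submatrix_equiv, hσb, Matrix.det_submatrix_equiv_self]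
    exact h2
  · rw [hG, ← transvection_submatrix_equiv e.symm b a (1 : ℝ[X]), hσa, hσb, Matrix.transpose_submatrix, Matrix.submatrix_mul_equiv,
      Matrix.submatrix_mul_equiv, Matrix.adjugate_submatrix_equiv_self, Matrix.submatrix_apply, hσb]
    exact h3
  · rw [hG, ← transvection_submatrix_equiv e.symm b a (-1 : ℝ[X]), hσa, hσb, Matrix.transpose_submatrix, Matrix.submatrix_mul_equiv,
      Matrix.submatrix_mul_equiv, Matrix.adjugate_submatrix_equiv_self, Matrix.submatrix_apply, hσb]
    exact h4
  · have hfar : (Matrix.single a a (1 : ℝ) - Matrix.single b b (1 : ℝ)).map (C : ℝ →+* ℝ[X]) =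
        (Matrix.single (Sum.inr 0 : Fin (q + 2) ⊕ Fin (q + 2)) (Sum.inr 0 : Fin (q + 2) ⊕ Fin (q + 2)) (1 : ℝ[X]) -
          Matrix.single (Sum.inr 1 : Fin (q + 2) ⊕ Fin (q + 2)) (Sum.inr 1 : Fin (q + 2) ⊕ Fin (q + 2)) (1 : ℝ[X])).submatrix
          e.symm e.symm := by
      ext x y
      simp only [Matrix.map_apply, Matrix.sub_apply, Matrix.submatrix_apply, Matrix.single_apply, ha, hb, map_sub,
        Equiv.apply_eq_iff_eq_symm_apply]
      split_ifs <;> simp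
    have hsub : ((∑ l, (X : ℝ[X]) ^ (![0, 1, D] : Fin 3 → ℕ) l • (T l).map C).submatrix e.symm e.symm +
        (X : ℝ[X]) ^ D' • (Matrix.single (Sum.inr 0 : Fin (q + 2) ⊕ Fin (q + 2)) (Sum.inr 0 : Fin (q + 2) ⊕ Fin (q + 2)) (1 : ℝ[X]) -
          Matrix.single (Sum.inr 1 : Fin (q + 2) ⊕ Fin (q + 2)) (Sum.inr 1 : Fin (q + 2) ⊕ Fin (q + 2)) (1 : ℝ[X])).submatrix
            e.symm e.symm) =
        ((∑ l, (X : ℝ[X]) ^ (![0, 1, D] : Fin 3 → ℕ) l • (T l).map C) +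
          (X : ℝ[X]) ^ D' • (Matrix.single (Sum.inr 0 : Fin (q + 2) ⊕ Fin (q + 2)) (Sum.inr 0) (1 : ℝ[X]) -
            Matrix.single (Sum.inr 1 : Fin (q + 2) ⊕ Fin (q + 2)) (Sum.inr 1) (1 : ℝ[X]))).submatrix e.symm e.symm := by
      ext x y
      simp only [Matrix.add_apply, Matrix.submatrix_apply, Matrix.smul_apply]
    rw [hG, hfar, hsub, Matrix.det_submatrix_equiv_self]
    exact h5

end AxisPairFinShape

end Summit.ValiantsHypothesis.ValiantsHypothesis.Theorems.KPlusLogSqLaw.TowerGraft
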